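import Summits.FinalStateConjecture.FinalStateConjecture.Theorems.EIHFluxBalanceInertialRecessionStubEndgameBasics

/-!
# Route EIHFluxBalance — crux `InertialRecession`, line `sublinear-is-free-clean-window-charges`:
# the endgame for a LINEARLY ISOLATED hole (covers `N ≤ 1` and the all-pairs-linear case)

Helper file for the crux `stmt-FinalStateConjecture-10166`
(`Summit.FinalStateConjecture.FinalStateConjecture.Theses.EIHFluxBalance.InertialRecession`), registered stub
`stub_cesaroEndgame` (lead reshape r2–r4 of `Cruxes/InertialRecession/Lines/sublinear-is-free-clean-window-charges.lean`).

In the abstract setting of the endgame (smooth centres `ξᵢ` in the cone `‖ξᵢ‖ ≤ κ²t`, slaved to continuous velocities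
`vᵢ` with `‖vᵢ‖ ≤ k < 1`, abstract charges `P` obeying the WINDOW LAW `|ΔP| ≤ C∫R^{-3/2}` on 2-Lipschitz δ-admissible
window paths above any threshold `ρ → ∞`, and IDENTIFICATION `P(window) = Σ_members Mⱼγⱼ(1, vⱼ) + ζ`, `ζ → 0`), a hole
`i` which is eventually LINEARLY ISOLATED — every other centre at distance `≥ σt`, `σ > 0` — has a convergent velocity and
hence a Cesàro velocity (`exists_tendsto_velocity_of_isolated`, `exists_cesaro_of_isolated`): the single-hole window
`c = ξᵢ(t)`, `R = c₁t`, `c₁ = min((κ−κ²)/2, σ/2)`, is admissible for all late `t` with `ρ = √t`, `δ = 1/2`; along it the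
window law integrates (`∫^∞ s^{-3/2} < ∞`), so the charge converges (`exists_tendsto_charge_of_linear_scale`), and
identification with `A = {i}` recovers `vᵢ` (`exists_tendsto_velocity_of_identified`). In particular the endgame holds
for `N ≤ 1` and whenever all pairs separate linearly (`liminf ‖ξᵢ − ξⱼ‖/t > 0`).

References: C. Marchal, D. Saari, J. Differential Equations 20 (1976) 150–186; D. Saari, Trans. AMS 156 (1971) 219–240.
-/

noncomputable section

set_option linter.dupNamespace false

open Filter Topology Set MeasureTheory intervalIntegral
open scoped Topology

namespace Summit.FinalStateConjecture.FinalStateConjecture.Theorems.SublinearIsFree.Endgame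

open Literature.Geometry.Lorentzian

/-- Late differentiable paths with speed eventually `≤ 2` are `2`-Lipschitz on late intervals. [folklore] -/
theorem lipschitz_two_of_deriv {ξ : ℝ → E3} (hd : Differentiable ℝ ξ) {T : ℝ} (hb : ∀ t, T ≤ t → ‖deriv ξ t‖ ≤ 2)
    {s s' : ℝ} (hs : T ≤ s) (hs' : T ≤ s') : ‖ξ s - ξ s'‖ ≤ 2 * |s - s'| := by
  have hconv : Convex ℝ (Ici T) := convex_Ici T
  have h := hconv.norm_image_sub_le_of_norm_deriv_le (f := ξ) (fun x _ ↦ hd.differentiableAt)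
    (fun x hx ↦ hb x hx) hs' hs
  rw [← Real.norm_eq_abs]
  simpa [Real.norm_eq_abs] using h

/-- CONVERGENT VELOCITY OF A LINEARLY ISOLATED HOLE (abstract endgame, isolated case). See the module docstring.
[folklore] -/
theorem exists_tendsto_velocity_of_isolated (N : ℕ) (M : Fin N → ℝ) (ξ v : Fin N → ℝ → E3) (κ : ℝ)
    (P : ℝ → E3 → ℝ → Fin 4 → ℝ) (hM : ∀ i, 0 < M i) (hκ0 : 0 < κ) (hκ1 : κ < 1)
    (hsmooth : ∀ i, ContDiff ℝ ((⊤ : ℕ∞) : WithTop ℕ∞) (ξ i))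
    (hcone : ∀ i, ∀ᶠ t in atTop, ‖ξ i t‖ ≤ κ ^ 2 * t)
    (hk : ∃ k : ℝ, 0 ≤ k ∧ k < 1 ∧ ∀ i t, ‖v i t‖ ≤ k)
    (hslave : ∀ i, Tendsto (fun t ↦ deriv (ξ i) t - v i t) atTop (𝓝 0))
    (hWL : ∀ ρ : ℝ → ℝ, Tendsto ρ atTop atTop → ∀ δ : ℝ, 0 < δ → δ < 1 → ∃ (C T : ℝ),
      ∀ (t₁ t₂ : ℝ) (c : ℝ → E3) (R : ℝ → ℝ), T ≤ t₁ → t₁ ≤ t₂ →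
      (∀ s ∈ Set.Icc t₁ t₂, ∀ s' ∈ Set.Icc t₁ t₂, ‖c s - c s'‖ ≤ 2 * |s - s'| ∧ |R s - R s'| ≤ 2 * |s - s'|) →
      (∀ s ∈ Set.Icc t₁ t₂, ρ s ≤ δ * R s ∧ ‖c s‖ + R s ≤ (κ + κ ^ 2) / 2 * s ∧
        ∀ j, ‖ξ j s - c s‖ ≤ (1 - δ) * R s ∨ (1 + δ) * R s ≤ ‖ξ j s - c s‖) →
      ∀ μ : Fin 4, |P t₂ (c t₂) (R t₂) μ - P t₁ (c t₁) (R t₁) μ| ≤ C * ∫ s in t₁..t₂, (R s ^ (3 / 2 : ℝ))⁻¹)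
    (hID : ∀ ρ : ℝ → ℝ, Tendsto ρ atTop atTop → ∀ δ : ℝ, 0 < δ → δ < 1 → ∃ (T : ℝ) (ζ : ℝ → ℝ),
      Tendsto ζ atTop (𝓝 0) ∧ ∀ (t : ℝ) (c : E3) (R : ℝ) (A : Finset (Fin N)), T ≤ t → ρ t ≤ δ * R →
      ‖c‖ + R ≤ (κ + κ ^ 2) / 2 * t →
      (∀ j, ‖ξ j t - c‖ ≤ (1 - δ) * R ∨ (1 + δ) * R ≤ ‖ξ j t - c‖) → (∀ j, j ∈ A ↔ ‖ξ j t - c‖ ≤ (1 - δ) * R) →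
      |P t c R 0 - ∑ j ∈ A, M j * (√(1 - ‖v j t‖ ^ 2))⁻¹| ≤ ζ t ∧
      ∀ k : Fin 3, |P t c R k.succ - ∑ j ∈ A, M j * (√(1 - ‖v j t‖ ^ 2))⁻¹ * v j t k| ≤ ζ t)
    (i : Fin N) {σ : ℝ} (hσ : 0 < σ) (hiso : ∀ j, j ≠ i → ∀ᶠ t in atTop, σ * t ≤ ‖ξ j t - ξ i t‖) :
    ∃ V : E3, Tendsto (v i) atTop (𝓝 V) := by
  obtain ⟨k, hk0, hk1, hvk⟩ := hk
  -- constants of the single-hole window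
  set c₁ : ℝ := min ((κ - κ ^ 2) / 2) (σ / 2) with hc₁
  have hκκ : 0 < κ - κ ^ 2 := by nlinarith
  have hc₁pos : 0 < c₁ := lt_min (by linarith) (by linarith)
  have hc₁le : c₁ ≤ (κ - κ ^ 2) / 2 := min_le_left _ _
  have hc₁σ : c₁ ≤ σ / 2 := min_le_right _ _
  have hc₁two : c₁ ≤ 2 := by
    have : (κ - κ ^ 2) / 2 ≤ 2 := by nlinarith
    exact hc₁le.trans this
  -- the window law and identification at threshold `ρ = √t`, clearance `δ = 1/2`
  have hρ : Tendsto (fun t : ℝ ↦ √t) atTop atTop := by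
    have := tendsto_rpow_atTop (show (0 : ℝ) < 1 / 2 by norm_num)
    refine this.congr' ?_
    filter_upwards [eventually_ge_atTop 0] with t ht
    rw [Real.sqrt_eq_rpow]
  obtain ⟨C, T_W, hW⟩ := hWL (fun t ↦ √t) hρ (1 / 2) (by norm_num) (by norm_num)
  obtain ⟨T_I, ζ, hζ, hI⟩ := hID (fun t ↦ √t) hρ (1 / 2) (by norm_num) (by norm_num)
  -- eventual facts, turned into thresholds
  have hdiff : Differentiable ℝ (ξ i) := (hsmooth i).differentiable (by simp)
  have hev_speed : ∀ᶠ t in atTop, ‖deriv (ξ i) t‖ ≤ 2 := by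
    have h1 : ∀ᶠ t in atTop, ‖deriv (ξ i) t - v i t‖ < 1 := by
      have := (tendsto_iff_norm_sub_tendsto_zero.mp (hslave i))
      simp only [sub_zero] at this
      exact this.eventually (gt_mem_nhds (by norm_num))
    filter_upwards [h1] with t ht
    calc ‖deriv (ξ i) t‖ = ‖(deriv (ξ i) t - v i t) + v i t‖ := by rw [sub_add_cancel]
      _ ≤ ‖deriv (ξ i) t - v i t‖ + ‖v i t‖ := norm_add_le _ _
      _ ≤ 1 + k := by linarith [hvk i t, ht.le]
      _ ≤ 2 := by linarith
  have hev_sqrt : ∀ᶠ t : ℝ in atTop, √t ≤ 1 / 2 * (c₁ * t) := by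
    filter_upwards [eventually_ge_atTop (4 / c₁ ^ 2), eventually_ge_atTop (0 : ℝ)] with t ht ht0
    have hc2 : 0 < c₁ ^ 2 := by positivity
    have ht' : 4 ≤ c₁ ^ 2 * t := by
      have := (div_le_iff₀ hc2).mp ht
      linarith
    have hy : 0 ≤ 1 / 2 * (c₁ * t) := by positivity
    have hle : t ≤ (1 / 2 * (c₁ * t)) ^ 2 := by nlinarith
    calc √t ≤ √((1 / 2 * (c₁ * t)) ^ 2) := Real.sqrt_le_sqrt hle
      _ = 1 / 2 * (c₁ * t) := Real.sqrt_sq hy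
  have hev_iso : ∀ᶠ t in atTop, ∀ j, j ≠ i → σ * t ≤ ‖ξ j t - ξ i t‖ := by
    have : ∀ j, ∀ᶠ t in atTop, j ≠ i → σ * t ≤ ‖ξ j t - ξ i t‖ := fun j ↦ by
      by_cases hj : j = i
      · exact Eventually.of_forall fun t h ↦ absurd hj h
      · exact (hiso j hj).mono fun t ht _ ↦ ht
    exact (eventually_all.mpr this).mono fun t ht j hj ↦ ht j hj
  obtain ⟨T₀, hT₀⟩ := eventually_atTop.mp ((((hcone i).and hev_speed).and hev_sqrt).and hev_iso)
  -- the master threshold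
  set T : ℝ := max (max (max T₀ T_W) T_I) 1 with hTdef
  have hT0 : T₀ ≤ T := ((le_max_left _ _).trans (le_max_left _ _)).trans (le_max_left _ _)
  have hTW : T_W ≤ T := ((le_max_right _ _).trans (le_max_left _ _)).trans (le_max_left _ _)
  have hTI : T_I ≤ T := (le_max_right _ _).trans (le_max_left _ _)
  have hT1 : 1 ≤ T := le_max_right _ _
  have hTpos : 0 < T := one_pos.trans_le hT1
  have hfacts : ∀ t, T ≤ t → ‖ξ i t‖ ≤ κ ^ 2 * t ∧ ‖deriv (ξ i) t‖ ≤ 2 ∧ √t ≤ 1 / 2 * (c₁ * t) ∧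
      ∀ j, j ≠ i → σ * t ≤ ‖ξ j t - ξ i t‖ := fun t ht ↦ by
    obtain ⟨⟨⟨h1, h2⟩, h3⟩, h4⟩ := hT₀ t (hT0.trans ht)
    exact ⟨h1, h2, h3, h4⟩
  -- admissibility of the single-hole window `(ξ i t, c₁ t)` at every `t ≥ T`
  have hadm : ∀ t, T ≤ t → √t ≤ 1 / 2 * (c₁ * t) ∧ ‖ξ i t‖ + c₁ * t ≤ (κ + κ ^ 2) / 2 * t ∧
      ∀ j, ‖ξ j t - ξ i t‖ ≤ (1 - 1 / 2) * (c₁ * t) ∨ (1 + 1 / 2) * (c₁ * t) ≤ ‖ξ j t - ξ i t‖ := by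
    intro t ht
    obtain ⟨hc, -, hs, hiso'⟩ := hfacts t ht
    have htpos : 0 < t := hTpos.trans_le ht
    refine ⟨hs, ?_, fun j ↦ ?_⟩
    · have : c₁ * t ≤ (κ - κ ^ 2) / 2 * t := mul_le_mul_of_nonneg_right hc₁le htpos.le
      linarith
    · by_cases hj : j = i
      · left; subst hj; simp only [sub_self, norm_zero]; positivity
      · right
        have h1 : (1 + 1 / 2) * (c₁ * t) ≤ σ * t := by
          have h2 : c₁ * t ≤ σ / 2 * t := mul_le_mul_of_nonneg_right hc₁σ htpos.le
          have h3 : 0 ≤ σ * t := (mul_pos hσ htpos).le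
          nlinarith
        exact h1.trans (hiso' j hj)
  -- the charge along the window path and the window law along it
  set Q : ℝ → Fin 4 → ℝ := fun t μ ↦ P t (ξ i t) (c₁ * t) μ with hQ
  have hlaw : ∀ t₁ t₂, T ≤ t₁ → t₁ ≤ t₂ → ∀ μ, |Q t₂ μ - Q t₁ μ| ≤
      C * ∫ s in t₁..t₂, ((c₁ * s) ^ (3 / 2 : ℝ))⁻¹ := by
    intro t₁ t₂ ht₁ h12 μ
    refine hW t₁ t₂ (ξ i) (fun s ↦ c₁ * s) (hTW.trans ht₁) h12 (fun s hs s' hs' ↦ ⟨?_, ?_⟩) ?_ μ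
    · exact lipschitz_two_of_deriv hdiff (fun t ht ↦ (hfacts t ht).2.1) (ht₁.trans hs.1) (ht₁.trans hs'.1)
    · rw [← mul_sub, abs_mul, abs_of_pos hc₁pos]
      exact mul_le_mul_of_nonneg_right hc₁two (abs_nonneg _)
    · intro s hs
      exact hadm s (ht₁.trans hs.1)
  have hconv : ∀ μ, ∃ L : ℝ, Tendsto (fun t ↦ Q t μ) atTop (𝓝 L) :=
    exists_tendsto_charge_of_linear_scale (R := fun s ↦ c₁ * s) hTpos hc₁pos
      ((continuous_const.mul continuous_id).continuousOn) (fun s _ ↦ le_rfl) hlaw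
  -- identification with the single member `i`
  have hmem : ∀ t, T ≤ t → ∀ j, j ∈ ({i} : Finset (Fin N)) ↔ ‖ξ j t - ξ i t‖ ≤ (1 - 1 / 2) * (c₁ * t) := by
    intro t ht j
    rw [Finset.mem_singleton]
    constructor
    · rintro rfl; simp only [sub_self, norm_zero]; have := hTpos.trans_le ht; positivity
    · intro hle
      by_contra hj
      have htpos : 0 < t := hTpos.trans_le ht
      have h1 := (hfacts t ht).2.2.2 j hj
      have h2 : c₁ * t ≤ σ / 2 * t := mul_le_mul_of_nonneg_right hc₁σ htpos.le
      have h3 : 0 < c₁ * t := mul_pos hc₁pos htpos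
      linarith
  have hid : ∀ t, T ≤ t → |Q t 0 - M i * (√(1 - ‖v i t‖ ^ 2))⁻¹| ≤ ζ t ∧
      ∀ kk : Fin 3, |Q t kk.succ - M i * (√(1 - ‖v i t‖ ^ 2))⁻¹ * v i t kk| ≤ ζ t := by
    intro t ht
    obtain ⟨hs, hcone', hclear⟩ := hadm t ht
    have h := hI t (ξ i t) (c₁ * t) {i} (hTI.trans ht) hs hcone' hclear (hmem t ht)
    simpa [hQ] using h
  exact exists_tendsto_velocity_of_identified (hM i) hk1 (hvk i) hζ hconv (fun t ht ↦ (hid t ht).1)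
    fun t ht kk ↦ (hid t ht).2 kk

/-- CESÀRO VELOCITY OF A LINEARLY ISOLATED HOLE: under the hypotheses of `exists_tendsto_velocity_of_isolated`,
`ξᵢ(t)/t` converges. In particular the endgame stub holds for `N ≤ 1` and for configurations in which all pairs
separate linearly. [folklore] -/
theorem exists_cesaro_of_isolated (N : ℕ) (M : Fin N → ℝ) (ξ v : Fin N → ℝ → E3) (κ : ℝ)
    (P : ℝ → E3 → ℝ → Fin 4 → ℝ) (hM : ∀ i, 0 < M i) (hκ0 : 0 < κ) (hκ1 : κ < 1)
    (hsmooth : ∀ i, ContDiff ℝ ((⊤ : ℕ∞) : WithTop ℕ∞) (ξ i))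
    (hcone : ∀ i, ∀ᶠ t in atTop, ‖ξ i t‖ ≤ κ ^ 2 * t)
    (hk : ∃ k : ℝ, 0 ≤ k ∧ k < 1 ∧ ∀ i t, ‖v i t‖ ≤ k)
    (hslave : ∀ i, Tendsto (fun t ↦ deriv (ξ i) t - v i t) atTop (𝓝 0))
    (hWL : ∀ ρ : ℝ → ℝ, Tendsto ρ atTop atTop → ∀ δ : ℝ, 0 < δ → δ < 1 → ∃ (C T : ℝ),
      ∀ (t₁ t₂ : ℝ) (c : ℝ → E3) (R : ℝ → ℝ), T ≤ t₁ → t₁ ≤ t₂ →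
      (∀ s ∈ Set.Icc t₁ t₂, ∀ s' ∈ Set.Icc t₁ t₂, ‖c s - c s'‖ ≤ 2 * |s - s'| ∧ |R s - R s'| ≤ 2 * |s - s'|) →
      (∀ s ∈ Set.Icc t₁ t₂, ρ s ≤ δ * R s ∧ ‖c s‖ + R s ≤ (κ + κ ^ 2) / 2 * s ∧
        ∀ j, ‖ξ j s - c s‖ ≤ (1 - δ) * R s ∨ (1 + δ) * R s ≤ ‖ξ j s - c s‖) →
      ∀ μ : Fin 4, |P t₂ (c t₂) (R t₂) μ - P t₁ (c t₁) (R t₁) μ| ≤ C * ∫ s in t₁..t₂, (R s ^ (3 / 2 : ℝ))⁻¹)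
    (hID : ∀ ρ : ℝ → ℝ, Tendsto ρ atTop atTop → ∀ δ : ℝ, 0 < δ → δ < 1 → ∃ (T : ℝ) (ζ : ℝ → ℝ),
      Tendsto ζ atTop (𝓝 0) ∧ ∀ (t : ℝ) (c : E3) (R : ℝ) (A : Finset (Fin N)), T ≤ t → ρ t ≤ δ * R →
      ‖c‖ + R ≤ (κ + κ ^ 2) / 2 * t →
      (∀ j, ‖ξ j t - c‖ ≤ (1 - δ) * R ∨ (1 + δ) * R ≤ ‖ξ j t - c‖) → (∀ j, j ∈ A ↔ ‖ξ j t - c‖ ≤ (1 - δ) * R) →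
      |P t c R 0 - ∑ j ∈ A, M j * (√(1 - ‖v j t‖ ^ 2))⁻¹| ≤ ζ t ∧
      ∀ k : Fin 3, |P t c R k.succ - ∑ j ∈ A, M j * (√(1 - ‖v j t‖ ^ 2))⁻¹ * v j t k| ≤ ζ t)
    (i : Fin N) {σ : ℝ} (hσ : 0 < σ) (hiso : ∀ j, j ≠ i → ∀ᶠ t in atTop, σ * t ≤ ‖ξ j t - ξ i t‖) :
    ∃ V : E3, Tendsto (fun t : ℝ ↦ t⁻¹ • ξ i t) atTop (𝓝 V) := by
  obtain ⟨V, hV⟩ := exists_tendsto_velocity_of_isolated N M ξ v κ P hM hκ0 hκ1 hsmooth hcone hk hslave hWL hID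
    i hσ hiso
  exact ⟨V, tendsto_inv_smul_of_slaved ((hsmooth i).differentiable (by simp)) (hslave i) hV⟩

/-- Registered helper form (verbatim signature) of `exists_cesaro_of_isolated`: a linearly isolated hole has a Cesàro
velocity. [folklore] -/
theorem endgame_cesaro_of_isolated : open Literature.Geometry.Lorentzian Filter Topology in ∀ (N : ℕ) (M : Fin N → ℝ) (ξ v : Fin N → ℝ → E3) (κ : ℝ) (P : ℝ → E3 → ℝ → Fin 4 → ℝ), (∀ i, 0 < M i) → 0 < κ → κ < 1 → (∀ i, ContDiff ℝ ((⊤ : ℕ∞) : WithTop ℕ∞) (ξ i)) → (∀ i, ∀ᶠ t in atTop, ‖ξ i t‖ ≤ κ ^ 2 * t) → (∃ k : ℝ, 0 ≤ k ∧ k < 1 ∧ ∀ i t, ‖v i t‖ ≤ k) → (∀ i, Tendsto (fun t ↦ deriv (ξ i) t - v i t) atTop (𝓝 0)) → (∀ ρ : ℝ → ℝ, Tendsto ρ atTop atTop → ∀ δ : ℝ, 0 < δ → δ < 1 → ∃ (C T : ℝ), ∀ (t₁ t₂ : ℝ) (c : ℝ → E3) (R : ℝ → ℝ), T ≤ t₁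 → t₁ ≤ t₂ → (∀ s ∈ Set.Icc t₁ t₂, ∀ s' ∈ Set.Icc t₁ t₂, ‖c s - c s'‖ ≤ 2 * |s - s'| ∧ |R s - R s'| ≤ 2 * |s - s'|) → (∀ s ∈ Set.Icc t₁ t₂, ρ s ≤ δ * R s ∧ ‖c s‖ + R s ≤ (κ + κ ^ 2) / 2 * s ∧ ∀ j, ‖ξ j s - c s‖ ≤ (1 - δ) * R s ∨ (1 + δ) * R s ≤ ‖ξ j s - c s‖) → ∀ μ : Fin 4, |P t₂ (c t₂) (R t₂) μ - P t₁ (c t₁) (R t₁) μ| ≤ C * ∫ s in t₁..t₂, (R s ^ (3 / 2 : ℝ))⁻¹) → (∀ ρ : ℝ → ℝ, Tendsto ρ atTop atTop → ∀ δ : ℝ, 0 < δ → δ < 1 → ∃ (T : ℝ) (ζ : ℝ → ℝ), Tendsto ζ atTop (𝓝 0) ∧ ∀ (t : ℝ) (c : E3) (R : ℝ) (A : Finset (Fin N)), T ≤ t → ρ t ≤ δ * R → ‖c‖ + R ≤ (κ + κ ^ 2) / 2 * t → (∀ j, ‖ξ j t - c‖ ≤ (1 - δ) * R ∨ (1 +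 δ) * R ≤ ‖ξ j t - c‖) → (∀ j, j ∈ A ↔ ‖ξ j t - c‖ ≤ (1 - δ) * R) → |P t c R 0 - ∑ j ∈ A, M j * (√(1 - ‖v j t‖ ^ 2))⁻¹| ≤ ζ t ∧ ∀ k : Fin 3, |P t c R k.succ - ∑ j ∈ A, M j * (√(1 - ‖v j t‖ ^ 2))⁻¹ * v j t k| ≤ ζ t) → ∀ (i : Fin N) (σ : ℝ), 0 < σ → (∀ j, j ≠ i → ∀ᶠ t in atTop, σ * t ≤ ‖ξ j t - ξ i t‖) → ∃ V : E3, Tendsto (fun t : ℝ ↦ t⁻¹ • ξ i t) atTop (𝓝 V) :=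
  fun N M ξ v κ P hM hκ0 hκ1 hsmooth hcone hk hslave hWL hID i _ hσ hiso ↦
    exists_cesaro_of_isolated N M ξ v κ P hM hκ0 hκ1 hsmooth hcone hk hslave hWL hID i hσ hiso

end Summit.FinalStateConjecture.FinalStateConjecture.Theorems.SublinearIsFree.Endgame

end
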